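import Literature.IUT.HodgeArakelov.StableCurveAgreementNonVacuitySubspace
import HarnessLib

/-!
# [IUTchII] Def 2.3 (i)(ii) / B13: the agreement over a CLOSED `±`-tower and the cuspidal datum generated by a geometric family

S. Mochizuki, *Inter-universal Teichmüller Theory II*, kurims manuscript (Dec. 2020), §2, Def 2.3 (i)(ii) pp. 67–68
(«`Π^±_v := Π^tp_{X_v}`, `Π̂^±_v := Π̂_{X_v}`», «cuspidal inertia groups … `Π_⊇`-conjugates … [cf. [AbsTopI], Lemma 4.5]»);
*Inter-universal Teichmüller Theory I* (May 2020), §2 p. 46 (cusps `x`, inertia groups `I_x ⊆ Δ^tp_X`)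
[cite: Mochizuki2012, II Def 2.3 (i)(ii) pp.67–68; I §2 p.46].  abc-iut cell, MERGE-MAP rows B13/B14 (plan/L6/MERGE-MAP.md),
lineage row «B13-GENUINE», seat abc-iut-w5-d132 (gen 4).  PROOF-ONLY (no `def`, no `instance`, no `structure`; every
witness is built INSIDE a theorem term), over LANDED modules only.

Purpose.  The companion `StableCurveAgreementNonVacuitySubspace.lean` (p421263) proves: for a `±`-tower `W`
(abc-iut-L6-t1's `PlusMinusTower`) with `Π̂^±_v` compact and `Δ̂^±_v` closed in it, and a cuspidal-inertia datum `C`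
whose `Π^±_v`-cuspidal inertia groups are geometric and `Π^±_v`-conjugation-stable, there is an [IUTchI] §2 datum `D`
(built from `W`, natural subspace topologies) and an agreement `StableCurveAgreement W C D`.  A GENUINE tower — the
producer «`PlusMinusTower.ofCoverModel`» of MERGE-MAP B14 (abc-iut-L6-t19), ambient `Π̂^cor_v` := a profinite
completion of `Π^tp_{C_v}`, `Π̂^±_v` := the kernel of a continuous map to a finite quotient, augmentation := a
continuous extension to `G_K` — meets those two side conditions for the reasons print takes for granted
(«profinite completions», p. 67): `Π̂^cor_v` is compact, `Π̂^±_v` is closed in it, the augmentation is continuous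
into a Hausdorff `G_v`.  This file records exactly that reduction, so that the instance at any such tower is ONE
application:

* `compactSpace_pmHat_of_isClosed`, `isClosed_ker_aug_pmHat` — the two side conditions of p421263 from
  «`Π̂^cor_v` compact, `Π̂^±_v` closed, `aug` continuous, `G_v` Hausdorff»;
* `exists_agreement_of_conj_invariant_closed` — p421263 over a CLOSED tower (those four hypotheses in place of
  `hcpt`/`hclosed`);
* `exists_cuspidalInertiaData_of_family` — the cuspidal-inertia datum GENERATED by a family `I : ι → Subgroup Π̂^cor_v`
  of GEOMETRIC subgroups of `Π^±_v` (print: the inertia groups `I_x ⊆ Δ` of the cusps `x`, [IUTchI] §2 p. 46, and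
  their conjugates, Def 2.3 (ii) p. 68): «`J` is a cuspidal inertia group of the level `Π_□`» :⇔ «`J ⊆ Π_□` and `J`
  is a `Π^±_v`-conjugate of some `I_i`» — it EXISTS (term built inside the proof), is characterised by exactly
  that clause, its `Π^±_v`-cuspidal groups are geometric and `Π^±_v`-conjugation-stable, and every `I_i` is one;
* `exists_agreement_of_geometric_family` — over a closed tower every geometric family yields such a `C` AND an
  agreement `∃ D, Nonempty (StableCurveAgreement W C D)` (honest label: GENUINE RELATIVE TO `(W, I)`; `D` is the
  record built from `W` by p421263 — special fibre `= Δ` with one component — not abc-iut-L5's stable-curve datum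
  of the special fibre, whose identification with `W` is the separate «common model» task, [IUTchI] Def 3.1 (e)).

Nothing of the series is asserted; consistency ≠ endorsement; no side taken on [IUTchIII] Cor 3.12.
-/

namespace Literature.IUT.HodgeArakelov

open Literature.IUT.HodgeTheaters
open scoped Pointwise

universe u v

variable {S : BadPlaceSetting.{u}} {P : TopGroup.{u}} {T : TemperedCoverings S P}

namespace PlusMinusTower

namespace StableCurveAgreement

/-! ### The two topological side conditions of p421263 over a closed tower -/

/-- **IUTchII:Def2.3(i)** (kurims p.67, «profinite completions») If `Π̂^cor_v` is compact and `Π̂^±_v` is closed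
in it, then `Π̂^±_v` is compact (hypothesis `hcpt` of `exists_agreement_of_conj_invariant_subspace`).
[cite: Mochizuki2012, II Def 2.3 (i) p.67] -/
theorem compactSpace_pmHat_of_isClosed (W : PlusMinusTower T) [CompactSpace W.Corhat]
    (hpm : IsClosed (W.pmHat : Set W.Corhat)) : CompactSpace W.pmHat :=
  isCompact_iff_compactSpace.mp hpm.isCompact

/-- **IUTchII:Def2.3(i)** (kurims p.67, «`Δ̂^±_v ⊆ Π̂^±_v`», the kernel of `Π̂^±_v → G_v`) If the augmentation
`Π̂^cor_v → G_v` is continuous and `G_v` is Hausdorff, then `Δ̂^±_v = Ker(Π̂^±_v → G_v)` is closed in `Π̂^±_v`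
(hypothesis `hclosed` of `exists_agreement_of_conj_invariant_subspace`). [cite: Mochizuki2012, II Def 2.3 (i) p.67] -/
theorem isClosed_ker_aug_pmHat (W : PlusMinusTower T) [T2Space S.Gk] (haug : Continuous W.aug) :
    IsClosed (((W.aug.comp W.pmHat.subtype).ker : Subgroup W.pmHat) : Set W.pmHat) := by
  rw [MonoidHom.coe_ker]
  exact isClosed_singleton.preimage (haug.comp continuous_subtype_val)

/-- **IUTchII:Def2.3(i)** (kurims p.67) **The agreement over a CLOSED tower.**  `exists_agreement_of_conj_invariant_subspace`
(p421263) with its two side conditions discharged from: `Π̂^cor_v` compact, `Π̂^±_v` closed in it, `aug` continuous,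
`G_v` Hausdorff.  PROVED. [cite: Mochizuki2012, II Def 2.3 (i)(ii) pp.67–68] -/
theorem exists_agreement_of_conj_invariant_closed (W : PlusMinusTower T) [CompactSpace W.Corhat] [T2Space S.Gk]
    (hpm : IsClosed (W.pmHat : Set W.Corhat)) (haug : Continuous W.aug) (C : CuspidalInertiaData W)
    (hgeom : ∀ I : Subgroup W.Corhat, C.IsCuspidalInertia W.piPM I → I ≤ W.aug.ker)
    (hconj : ∀ I : Subgroup W.Corhat, C.IsCuspidalInertia W.piPM I →
      ∀ t ∈ W.piPM, C.IsCuspidalInertia W.piPM (MulAut.conj t • I)) :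
    ∃ D : StableCurveTemperedData.{u}, Nonempty (StableCurveAgreement W C D) :=
  exists_agreement_of_conj_invariant_subspace W C (compactSpace_pmHat_of_isClosed W hpm)
    (isClosed_ker_aug_pmHat W haug) hgeom hconj

/-! ### The cuspidal-inertia datum generated by a geometric family -/

/-- Conjugating a subgroup of `Π^±_v` by an element of `Π^±_v` stays inside `Π^±_v`. [folklore] -/
private theorem conj_smul_le_of_le {G : Type u} [Group G] {Q J : Subgroup G} (hJ : J ≤ Q) {t : G} (ht : t ∈ Q) :
    MulAut.conj t • J ≤ Q := by
  intro x hx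
  rw [Subgroup.mem_smul_pointwise_iff_exists] at hx
  obtain ⟨y, hy, rfl⟩ := hx
  rw [MulAut.smul_def, MulAut.conj_apply]
  exact Q.mul_mem (Q.mul_mem ht (hJ hy)) (Q.inv_mem ht)

/-- Conjugating a subgroup of a normal subgroup stays inside it. [folklore] -/
private theorem conj_smul_le_of_le_normal {G : Type u} [Group G] {N J : Subgroup G} (hN : N.Normal) (hJ : J ≤ N)
    (t : G) : MulAut.conj t • J ≤ N := by
  intro x hx
  rw [Subgroup.mem_smul_pointwise_iff_exists] at hx
  obtain ⟨y, hy, rfl⟩ := hx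
  rw [MulAut.smul_def, MulAut.conj_apply]
  exact hN.conj_mem y (hJ hy) t

/-- **IUTchII:Def2.3(ii)** (kurims p.68; [IUTchI] §2 p.46 «`I_x ⊆ Δ^tp_X`») **The cuspidal-inertia datum GENERATED by a
geometric family.**  Let `I : ι → Subgroup Π̂^cor_v` be any family of subgroups of `Π^±_v` lying in `Δ̂^cor_v = Ker(aug)`
(print: the inertia groups of the cusps).  Then there is a cuspidal-inertia datum `C` on the tower (abc-iut-L6-t1's
`CuspidalInertiaData W`, built inside the proof) such that, at EVERY level `Π_□`, «`J` is a cuspidal inertia group of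
`Π_□`» iff «`J ⊆ Π_□` and `J = t I_i t⁻¹` for some `i` and some `t ∈ Π^±_v`»; in particular its `Π^±_v`-cuspidal inertia
groups are GEOMETRIC (`⊆ Ker(aug)`) and stable under `Π^±_v`-conjugation (the two inputs of the agreement), and every
`I_i` is one of them.  PROVED. [cite: Mochizuki2012, II Def 2.3 (ii) p.68; I §2 p.46] -/
theorem exists_cuspidalInertiaData_of_family (W : PlusMinusTower T) {ι : Sort v} (I : ι → Subgroup W.Corhat)
    (hIpm : ∀ i, I i ≤ W.piPM) (hIΔ : ∀ i, I i ≤ W.aug.ker) :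
    ∃ C : CuspidalInertiaData W,
      (∀ Q J : Subgroup W.Corhat, C.IsCuspidalInertia Q J ↔ J ≤ Q ∧ ∃ i, ∃ t ∈ W.piPM, J = MulAut.conj t • I i) ∧
      (∀ J : Subgroup W.Corhat, C.IsCuspidalInertia W.piPM J → J ≤ W.aug.ker) ∧
      (∀ J : Subgroup W.Corhat, C.IsCuspidalInertia W.piPM J →
        ∀ t ∈ W.piPM, C.IsCuspidalInertia W.piPM (MulAut.conj t • J)) ∧
      (∀ i, C.IsCuspidalInertia W.piPM (I i)) := by
  let C : CuspidalInertiaData W :=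
    { IsCuspidalInertia := fun Q J => J ≤ Q ∧ ∃ i, ∃ t ∈ W.piPM, J = MulAut.conj t • I i
      le_of_isCuspidalInertia := fun h => h.1 }
  refine ⟨C, fun Q J => Iff.rfl, ?_, ?_, ?_⟩
  · -- geometric: `t I_i t⁻¹ ⊆ Ker(aug)` since `Ker(aug)` is normal
    rintro J ⟨-, i, t, -, rfl⟩
    exact conj_smul_le_of_le_normal (MonoidHom.normal_ker W.aug) (hIΔ i) t
  · -- conjugation-stable: `s (t I_i t⁻¹) s⁻¹ = (s t) I_i (s t)⁻¹`
    rintro J ⟨-, i, t, ht, rfl⟩ s hs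
    refine ⟨?_, i, s * t, W.piPM.mul_mem hs ht, ?_⟩
    · exact conj_smul_le_of_le (conj_smul_le_of_le (hIpm i) ht) hs
    · rw [map_mul, mul_smul]
  · -- every `I_i` is cuspidal: `I_i = 1 I_i 1⁻¹`
    intro i
    exact ⟨hIpm i, i, 1, W.piPM.one_mem, by rw [map_one, one_smul]⟩

/-- **IUTchII:Def2.3(i)(ii)** (kurims pp.67–68) **B13 over a CLOSED tower with a geometric family — GENUINE RELATIVE TO
`(W, I)`.**  Over a `±`-tower with `Π̂^cor_v` compact, `Π̂^±_v` closed, `aug` continuous into a Hausdorff `G_v`, every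
family `I` of geometric subgroups of `Π^±_v` generates a cuspidal-inertia datum `C` (characterised at every level as in
`exists_cuspidalInertiaData_of_family`) for which an [IUTchI] §2 datum `D` and an agreement `StableCurveAgreement W C D`
EXIST (the `D` of p421263, built from `W`: honest label — special fibre `= Δ` with one component).  This is the form
the instance at the cover-model tower of MERGE-MAP B14 applies verbatim.  PROVED.
[cite: Mochizuki2012, II Def 2.3 (i)(ii) pp.67–68; I §2 p.46] -/
theorem exists_agreement_of_geometric_family (W : PlusMinusTower T) [CompactSpace W.Corhat] [T2Space S.Gk]
    (hpm : IsClosed (W.pmHat : Set W.Corhat)) (haug : Continuous W.aug)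
    {ι : Sort v} (I : ι → Subgroup W.Corhat) (hIpm : ∀ i, I i ≤ W.piPM) (hIΔ : ∀ i, I i ≤ W.aug.ker) :
    ∃ C : CuspidalInertiaData W,
      (∀ Q J : Subgroup W.Corhat, C.IsCuspidalInertia Q J ↔ J ≤ Q ∧ ∃ i, ∃ t ∈ W.piPM, J = MulAut.conj t • I i) ∧
      (∀ i, C.IsCuspidalInertia W.piPM (I i)) ∧
      ∃ D : StableCurveTemperedData.{u}, Nonempty (StableCurveAgreement W C D) := by
  obtain ⟨C, hchar, hgeom, hconj, hI⟩ := exists_cuspidalInertiaData_of_family W I hIpm hIΔ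
  exact ⟨C, hchar, hI, exists_agreement_of_conj_invariant_closed W hpm haug C hgeom hconj⟩

end StableCurveAgreement

end PlusMinusTower

end Literature.IUT.HodgeArakelov
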